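import Literature.Geometry.Symplectic.JSphereLocalFoliation
import Literature.Geometry.Symplectic.JSphereNotNullHomotopic
import HarnessLib

/-!
# The Hofer–Lizan–Sikorav local foliation fact reduces to its existence half

Support theorem (no new named fact, D-0026) for
`Literature.Geometry.Symplectic.hls_localFoliation_embeddedSphere_trivialNormal`
(`JSphereLocalFoliation.lean`; Wendl 2018, Prop. 2.53 with Thm. 2.49, the `m = 0` case; Hofer,
Lizan and Sikorav 1997, Thm. 1). The conclusion of that fact lists eight properties of the family
`(U a, V a)_{|a| < ε}`; the first seven (through `S`, embedded `J`-holomorphic leaves, joint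
smoothness in `(a, z)`, pairwise disjointness, joint immersion, open swept set) are the EXISTENCE
content of Prop. 2.53, the eighth (a homotopic `J`-sphere meeting the swept set is a leaf) is its
UNIQUENESS content, proved in the tree from the first seven as
`Literature.Geometry.Symplectic.hls_uniqueness_of_localFamily'` (`JSphereNotNullHomotopic.lean`,
on top of `JSphereLocalFoliationUniqueness.lean`: positivity of intersections, the leaf
function of the family, the homological intersection index, and `c₁ = 2 ≠ 0` for the leaves).
`hls_localFoliation_embeddedSphere_trivialNormal_of_existence` records the resulting reduction:
the fact follows from the statement obtained by deleting its eighth property. (The existence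
half — the Fredholm theory of the normal Cauchy–Riemann operator with automatic transversality,
Wendl 2018 Thm. 2.46 and Prop. 2.53 — is not in the tree.)

## References

* C. Wendl, *Holomorphic Curves in Low Dimensions*, LNM 2216, Springer (2018), Prop. 2.53,
  Thm. 2.49, Thm. 2.46. [Wendl2018]
* H. Hofer, V. Lizan, J.-C. Sikorav, *On genericity for holomorphic curves in four-dimensional
  almost-complex manifolds*, J. Geom. Anal. 7 (1998) 149–159, Thm. 1. [HoferLizanSikorav1997]
-/

noncomputable section

open scoped Manifold ContDiff Topology
open Set Function Literature.Topology.FourManifolds Literature.Topology.FourManifolds.ComplexProjectiveSpace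

namespace Literature.Geometry.Symplectic

/-- **The Hofer–Lizan–Sikorav fact reduces to its existence half.** If every embedded
`J`-holomorphic two-chart sphere with trivial normal bundle sits in a family with the seven listed
properties (through `S`, embedded `J`-leaves, joint smoothness, disjointness, joint immersion, open
swept set) — the EXISTENCE content of Wendl 2018, Prop. 2.53 — then
`hls_localFoliation_embeddedSphere_trivialNormal` holds: the eighth property, uniqueness by
positivity of intersections, is `hls_uniqueness_of_localFamily'` for that family.
[cite: Wendl2018, Prop. 2.53 and Thm. 2.49] -/
theorem hls_localFoliation_embeddedSphere_trivialNormal_of_existence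
    (hex : ∀ (X : Type) [TopologicalSpace X] [T2Space X] [SecondCountableTopology X]
      [ChartedSpace (EuclideanSpace ℝ (Fin 4)) X] [IsManifold (𝓡 4) ∞ X]
      (JX : AlmostComplexStructure (𝓡 4) ∞ X) (u₀ v₀ : ℂ → X) (N : Set X) (πN : X → ℂ),
      ContMDiff 𝓘(ℝ, ℂ) (𝓡 4) ∞ u₀ → ContMDiff 𝓘(ℝ, ℂ) (𝓡 4) ∞ v₀ → (∀ z : ℂ, z ≠ 0 → v₀ z = u₀ z⁻¹) →
      IsJHolomorphic (𝓡 4) (fun y => JX y) u₀ → IsJHolomorphic (𝓡 4) (fun y => JX y) v₀ →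
      Injective u₀ → (∀ z, Injective (mfderiv 𝓘(ℝ, ℂ) (𝓡 4) u₀ z)) →
      Injective (mfderiv 𝓘(ℝ, ℂ) (𝓡 4) v₀ 0) → v₀ 0 ∉ range u₀ →
      IsOpen N → range u₀ ∪ {v₀ 0} ⊆ N → ContMDiffOn (𝓡 4) 𝓘(ℝ, ℂ) ∞ πN N →
      (∀ y ∈ N, Surjective (mfderiv (𝓡 4) 𝓘(ℝ, ℂ) πN y)) →
      {y | y ∈ N ∧ πN y = 0} = range u₀ ∪ {v₀ 0} →
      ∃ (ε : ℝ) (U V : ℂ → ℂ → X), 0 < ε ∧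
        (∀ z, U 0 z = u₀ z) ∧ (∀ w, V 0 w = v₀ w) ∧
        (∀ a : ℂ, ‖a‖ < ε →
          ContMDiff 𝓘(ℝ, ℂ) (𝓡 4) ∞ (U a) ∧ ContMDiff 𝓘(ℝ, ℂ) (𝓡 4) ∞ (V a) ∧
          (∀ z : ℂ, z ≠ 0 → V a z = U a z⁻¹) ∧
          IsJHolomorphic (𝓡 4) (fun y => JX y) (U a) ∧ IsJHolomorphic (𝓡 4) (fun y => JX y) (V a) ∧
          Injective (U a) ∧ (∀ z, Injective (mfderiv 𝓘(ℝ, ℂ) (𝓡 4) (U a) z)) ∧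
          Injective (mfderiv 𝓘(ℝ, ℂ) (𝓡 4) (V a) 0) ∧ V a 0 ∉ range (U a)) ∧
        ContMDiffOn 𝓘(ℝ, ℂ × ℂ) (𝓡 4) ∞ (fun q : ℂ × ℂ => U q.1 q.2) (Metric.ball 0 ε ×ˢ univ) ∧
        ContMDiffOn 𝓘(ℝ, ℂ × ℂ) (𝓡 4) ∞ (fun q : ℂ × ℂ => V q.1 q.2) (Metric.ball 0 ε ×ˢ univ) ∧
        (∀ a a' : ℂ, ‖a‖ < ε → ‖a'‖ < ε → a ≠ a' →
          Disjoint (range (U a) ∪ {V a 0}) (range (U a') ∪ {V a' 0})) ∧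
        (∀ q ∈ Metric.ball (0 : ℂ) ε ×ˢ (univ : Set ℂ),
          Injective (mfderiv 𝓘(ℝ, ℂ × ℂ) (𝓡 4) (fun q : ℂ × ℂ => U q.1 q.2) q) ∧
          Injective (mfderiv 𝓘(ℝ, ℂ × ℂ) (𝓡 4) (fun q : ℂ × ℂ => V q.1 q.2) q)) ∧
        IsOpen (⋃ a ∈ Metric.ball (0 : ℂ) ε, (range (U a) ∪ {V a 0}))) :
    hls_localFoliation_embeddedSphere_trivialNormal := by
  intro X _ _ _ _ _ JX u₀ v₀ N πN hu₀ hv₀ huv₀ hJu₀ hJv₀ hinj himm₀ himmv hnot hN hsub hπ hπs hzero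
  obtain ⟨ε, U, V, hε, hU0, hV0, hleaf, hUs, hVs, hdisj, himm, hopen⟩ :=
    hex X JX u₀ v₀ N πN hu₀ hv₀ huv₀ hJu₀ hJv₀ hinj himm₀ himmv hnot hN hsub hπ hπs hzero
  refine ⟨ε, U, V, hε, hU0, hV0, hleaf, hUs, hVs, hdisj, himm, hopen, ?_⟩
  intro u v F F₀ hu hv huv hJu hJv hF0 hF1 hF₀0 hF₀1 hhom hmeet
  exact hls_uniqueness_of_localFamily' hε hleaf hUs hVs hdisj himm hU0 hV0 hu hv huv hJu hJv hF0 hF1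
    hF₀0 hF₀1 hhom hmeet

/-- **Sharper reduction: the open-swept-set property is automatic.** The seventh property of the
family (the swept set `⋃_{|a|<ε} (U a)(ℂ) ∪ {V a 0}` is open) follows from the others — the
parametrisations `Φ_U`, `Φ_V` are injective immersions of the 4-dimensional `B_ε × ℂ` into the
4-manifold `X`, hence open maps (`Literature.Geometry.Symplectic.isOpen_sweep`). So the fact
follows from the statement listing only: through `S`, embedded `J`-holomorphic two-chart leaves,
joint smoothness, pairwise disjointness and joint immersion. [cite: Wendl2018, Prop. 2.53 and Thm. 2.49] -/
theorem hls_localFoliation_embeddedSphere_trivialNormal_of_existence'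
    (hex : ∀ (X : Type) [TopologicalSpace X] [T2Space X] [SecondCountableTopology X]
      [ChartedSpace (EuclideanSpace ℝ (Fin 4)) X] [IsManifold (𝓡 4) ∞ X]
      (JX : AlmostComplexStructure (𝓡 4) ∞ X) (u₀ v₀ : ℂ → X) (N : Set X) (πN : X → ℂ),
      ContMDiff 𝓘(ℝ, ℂ) (𝓡 4) ∞ u₀ → ContMDiff 𝓘(ℝ, ℂ) (𝓡 4) ∞ v₀ → (∀ z : ℂ, z ≠ 0 → v₀ z = u₀ z⁻¹) →
      IsJHolomorphic (𝓡 4) (fun y => JX y) u₀ → IsJHolomorphic (𝓡 4) (fun y => JX y) v₀ →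
      Injective u₀ → (∀ z, Injective (mfderiv 𝓘(ℝ, ℂ) (𝓡 4) u₀ z)) →
      Injective (mfderiv 𝓘(ℝ, ℂ) (𝓡 4) v₀ 0) → v₀ 0 ∉ range u₀ →
      IsOpen N → range u₀ ∪ {v₀ 0} ⊆ N → ContMDiffOn (𝓡 4) 𝓘(ℝ, ℂ) ∞ πN N →
      (∀ y ∈ N, Surjective (mfderiv (𝓡 4) 𝓘(ℝ, ℂ) πN y)) →
      {y | y ∈ N ∧ πN y = 0} = range u₀ ∪ {v₀ 0} →
      ∃ (ε : ℝ) (U V : ℂ → ℂ → X), 0 < ε ∧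
        (∀ z, U 0 z = u₀ z) ∧ (∀ w, V 0 w = v₀ w) ∧
        (∀ a : ℂ, ‖a‖ < ε →
          ContMDiff 𝓘(ℝ, ℂ) (𝓡 4) ∞ (U a) ∧ ContMDiff 𝓘(ℝ, ℂ) (𝓡 4) ∞ (V a) ∧
          (∀ z : ℂ, z ≠ 0 → V a z = U a z⁻¹) ∧
          IsJHolomorphic (𝓡 4) (fun y => JX y) (U a) ∧ IsJHolomorphic (𝓡 4) (fun y => JX y) (V a) ∧
          Injective (U a) ∧ (∀ z, Injective (mfderiv 𝓘(ℝ, ℂ) (𝓡 4) (U a) z)) ∧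
          Injective (mfderiv 𝓘(ℝ, ℂ) (𝓡 4) (V a) 0) ∧ V a 0 ∉ range (U a)) ∧
        ContMDiffOn 𝓘(ℝ, ℂ × ℂ) (𝓡 4) ∞ (fun q : ℂ × ℂ => U q.1 q.2) (Metric.ball 0 ε ×ˢ univ) ∧
        ContMDiffOn 𝓘(ℝ, ℂ × ℂ) (𝓡 4) ∞ (fun q : ℂ × ℂ => V q.1 q.2) (Metric.ball 0 ε ×ˢ univ) ∧
        (∀ a a' : ℂ, ‖a‖ < ε → ‖a'‖ < ε → a ≠ a' →
          Disjoint (range (U a) ∪ {V a 0}) (range (U a') ∪ {V a' 0})) ∧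
        (∀ q ∈ Metric.ball (0 : ℂ) ε ×ˢ (univ : Set ℂ),
          Injective (mfderiv 𝓘(ℝ, ℂ × ℂ) (𝓡 4) (fun q : ℂ × ℂ => U q.1 q.2) q) ∧
          Injective (mfderiv 𝓘(ℝ, ℂ × ℂ) (𝓡 4) (fun q : ℂ × ℂ => V q.1 q.2) q))) :
    hls_localFoliation_embeddedSphere_trivialNormal := by
  refine hls_localFoliation_embeddedSphere_trivialNormal_of_existence ?_
  intro X _ _ _ _ _ JX u₀ v₀ N πN hu₀ hv₀ huv₀ hJu₀ hJv₀ hinj himm₀ himmv hnot hN hsub hπ hπs hzero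
  obtain ⟨ε, U, V, hε, hU0, hV0, hleaf, hUs, hVs, hdisj, himm⟩ :=
    hex X JX u₀ v₀ N πN hu₀ hv₀ huv₀ hJu₀ hJv₀ hinj himm₀ himmv hnot hN hsub hπ hπs hzero
  exact ⟨ε, U, V, hε, hU0, hV0, hleaf, hUs, hVs, hdisj, himm, isOpen_sweep hleaf hUs hVs himm⟩

end Literature.Geometry.Symplectic

end
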